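import Summits.QuantumFields.BalabanUV.T4Continuum.Support.T4TrajectoryDensityFreshStep

/-!
# `T4Continuum.T4TrajectoryDensityFreshEnvelope` — the per-step bootstrap for REGENERATING families: the fresh law fed by a
# per-FAMILY envelope response (all live generations of a family summed with the booking's envelope) instead of §14's
# one-birth-scale terms (cell `pub-balaban`, sub-cell `t4`, spine estimate NE1′ (node O3b/H2), lineage t4-ne1p-p1 = PROVER seat
# P1 «RG-trajectory comparison», generation 22; tree target `Summits/QuantumFields/BalabanUV/T4Continuum/Support/`; ADDITIVE —
# imports `T4TrajectoryDensityFreshStep` ONLY)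

HONEST FRAMING.  Finite four-torus, rung (B)+1 only — NOT infinite volume, NOT a mass gap, NOT the Clay problem, NOT summit
progress.  «continuum YM on T⁴ ⇐ BetaPertH ∧ nine spine estimates (0/9 proved); BetaPertH ⇐ (D1) ∧ (D4) ∧ CAP+tail; G-an2-4
gates asym, D1 and NE2/3/4».  [folklore] real-number bookkeeping, 0 sorry, 0 citations; every rate is a HYPOTHESIS SHAPE of
the cell's format (record `t4/T4-EST-NE1p-P1.md` §4), never asserted for Bałaban's densities or the cell's D-terms.

WHY THIS LEAF (scope note on §14, same generation).  `T4TrajectoryDensityFreshLaw.freshLaw_of_pipeline` indexes the live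
observable-attached TERMS by ONE birth scale each, with birth size `Â·τ^{K−j}` and TRANSVERSE fresh defect `c_δψ^{k−j}` counted from
that birth: this is exact for TRANSPORTED terms (the first-order terms carried spectator-exactly through the 𝕋-steps, no
regeneration — `T4TrajectoryComparison.RegeneratesFromVar` with `c = 0`).  In the format's general case a family born at `j`
REGENERATES a new generation at every later scale `k′` (size `gen b k′ ≤ c·size b (k′−1)`), and the fresh response of the family at
step `k` is the SUM over its live generations `Σ_{k′∈[j,k]} (4/r)·(gen b k′·e^{3(k−k′)})·c_δψ^{k−k′}` — which is, up to the
constant `4c_δ/r`, the booking's ENVELOPE `T4TrajectoryComparison.Trajectory.envVar 1 (fun _ => e³ψ) b k` of the family with the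
dressed rate `e³ψ` (`envVar C ρ b k = Σ_{k′∈[j,k]} C·(∏_{[k′,k)} ρ)·gen b k′`).  The booking bounds envelopes by product-rate classes
`A·(∏(ρ + C·c))·τ^{K−j}` under its own class compatibility (`sizeBound_gates_prodRate`); so for a regenerating family the fresh
response at step `k` has the profile `R̂·ρ₁^{k−j}·τ^{K−j}` with a per-step FAMILY rate `ρ₁` (of the type `e³ψ + C·c`), and the
per-step bootstrap closes under the strict product `Λ·ρ₁·τ < 1`.  This leaf types exactly that: the shape `EnvelopeResponse`
(per family, under the budget history — to be fed by §15's slices × the booking's envelope, a scale-by-scale composition NOT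
done here), `freshLaw_of_envelope` (⟹ `FreshLawUnderBudget` with the rate slot `ψ := ρ₁/e³`, `c_δ := R̂`, `Â := 1`), and
`perStep_budget_of_envelope` (`perStep_bootstrap` by name: ∀ `k < K`, `s⁰ k + s₁ k ≤ 1` under `Λ·ρ₁·τ ≤ ρ < 1` and the K-FREE
smallness `c·N₀R̂(1−ρ)⁻¹ ≤ 1 − s̄⁰`).  So the regenerating case costs the SAME kind of input as §14 — one more factor in the per-step
rate (`e³ψ ↦ e³ψ + C·c`, the O-G2 regeneration constant of (w7)) — and no summability.
-/

namespace Summit.QuantumFields.BalabanUV.T4Continuum.T4TrajectoryDensityDressed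

open Literature.MathematicalPhysics.QuantumFieldTheory.Balaban1983to89

noncomputable section

section Envelope

open Finset

variable {ι : Type*}

/-- HYPOTHESIS SHAPE — **PER-FAMILY ENVELOPE RESPONSE** (cell format; never asserted for Bałaban's densities): at every step
`k < K`, under the budget history `s⁰ i + s₁ i ≤ 1` (`i < k`), every live family `f ∈ S k` (birth scale `jb f ≤ k`) responds to
the fresh fluctuation pair of step `k` by at most `R̂·ρ₁^{k−jb f}·τ^{K−jb f}` — the sum over its live generations of
(current slice size) × (transverse fresh defect) ÷ (radius), i.e. `(4c_δ/r_*)`× the booking's envelope of the family with the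
dressed per-step rate `ρ₁` (type `e³ψ + C·c`: transport × step cost + regeneration).  To be supplied by §15's slices and
`T4TrajectoryComparison`'s envelope induction scale by scale. [folklore] -/
def EnvelopeResponse (resp : ℕ → ι → ℝ) (s₀ s₁ : ℕ → ℝ) (S : ℕ → Finset ι) (jb : ι → ℕ) (Rhat ρ₁ τ : ℝ) (K : ℕ) :
    Prop :=
  ∀ k < K, (∀ i < k, s₀ i + s₁ i ≤ 1) → ∀ f ∈ S k, resp k f ≤ Rhat * ρ₁ ^ (k - jb f) * τ ^ (K - jb f)

/-- **THE FRESH LAW FROM ENVELOPE RESPONSES.**  Envelope responses `≤ R̂·ρ₁^{k−j}·τ^{K−j}` per live family of birth scale `j`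
(under the budget history), positional counts `#{f ∈ S k : jb f = j} ≤ N₀·Λ^{k−j}`, birth scales `≤ k`, `ρ₁, τ ≥ 0`, and the
fresh budget `s₁ k ≤ c·Σ_{f∈S k} resp k f` (`c ≥ 0`) give `FreshLawUnderBudget s⁰ s₁ c N₀ R̂ 1 Λ (ρ₁/e³) τ K` — §13's shape with
the rate slot carrying the FAMILY rate `ρ₁` (`e³·(ρ₁/e³) = ρ₁`). [folklore] -/
theorem freshLaw_of_envelope {resp : ℕ → ι → ℝ} {s₀ s₁ : ℕ → ℝ} {S : ℕ → Finset ι} {jb : ι → ℕ}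
    {c N₀ Rhat Λ ρ₁ τ : ℝ} {K : ℕ} (hc : 0 ≤ c) (hρ₁ : 0 ≤ ρ₁) (hτ : 0 ≤ τ) (hRhat : 0 ≤ Rhat)
    (hjb : ∀ k, ∀ f ∈ S k, jb f ≤ k)
    (hresp : EnvelopeResponse resp s₀ s₁ S jb Rhat ρ₁ τ K)
    (hcount : ∀ k, ∀ j ≤ k, (((S k).filter fun f => jb f = j).card : ℝ) ≤ N₀ * Λ ^ (k - j))
    (hs₁ : ∀ k < K, s₁ k ≤ c * ∑ f ∈ S k, resp k f) :
    FreshLawUnderBudget s₀ s₁ c N₀ Rhat 1 Λ (ρ₁ / Real.exp 3) τ K := by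
  intro k hk hbud
  have hrate : Real.exp 3 * (ρ₁ / Real.exp 3) = ρ₁ := by field_simp
  set g : ℕ → ℝ := fun j => Rhat * ρ₁ ^ (k - j) * τ ^ (K - j) with hg
  have hg0 : ∀ j, 0 ≤ g j := fun j => by rw [hg]; positivity
  -- regroup the family sum by birth scale (T4TrajectoryDensityFreshLaw's `sum_by_birthScale`, re-proved inline to keep imports minimal)
  have hregroup : ∑ f ∈ S k, g (jb f) = ∑ j ∈ range (k + 1), (((S k).filter fun f => jb f = j).card : ℝ) * g j := by
    classical
    rw [← sum_fiberwise_of_maps_to (s := S k) (t := range (k + 1)) (g := jb)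
      (fun f hf => mem_range_succ_iff.mpr (hjb k f hf)) (fun f => g (jb f))]
    refine sum_congr rfl fun j _ => ?_
    rw [sum_congr rfl (fun f hf => by rw [(mem_filter.mp hf).2] : ∀ f ∈ (S k).filter (fun f => jb f = j), g (jb f) = g j),
      sum_const, nsmul_eq_mul]
  calc s₁ k ≤ c * ∑ f ∈ S k, resp k f := hs₁ k hk
    _ ≤ c * ∑ f ∈ S k, g (jb f) :=
        mul_le_mul_of_nonneg_left (sum_le_sum fun f hf => by rw [hg]; exact hresp k hk hbud f hf) hc
    _ = c * ∑ j ∈ range (k + 1), (((S k).filter fun f => jb f = j).card : ℝ) * g j := by rw [hregroup]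
    _ ≤ c * ∑ j ∈ range (k + 1), N₀ * Λ ^ (k - j) * g j := by
        refine mul_le_mul_of_nonneg_left (sum_le_sum fun j hj => ?_) hc
        exact mul_le_mul_of_nonneg_right (hcount k j (mem_range_succ_iff.mp hj)) (hg0 j)
    _ = c * ∑ j ∈ range (k + 1),
          N₀ * Λ ^ (k - j) * (Rhat * (Real.exp 3 * (ρ₁ / Real.exp 3)) ^ (k - j)) * (1 * τ ^ (K - j)) := by
        rw [hrate]
        congr 1
        refine sum_congr rfl fun j _ => ?_
        rw [hg]
        ring

/-- **THE PER-STEP BUDGET FOR REGENERATING FAMILIES** (`perStep_bootstrap` by name): envelope responses + counts + the fresh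
budget + a per-step action margin `s⁰ k ≤ s̄⁰` + the strict product at the FAMILY rate `Λ·ρ₁·τ ≤ ρ < 1` (`0 ≤ τ ≤ 1`) + the K-FREE
smallness `c·(N₀·R̂·(1−ρ)⁻¹) ≤ 1 − s̄⁰` ⟹ for every `k < K`: `s⁰ k + s₁ k ≤ 1` and `s₁ k ≤ c·(N₀R̂(1−ρ)⁻¹)·τ^{K−k}`.  With
`ρ₁ = e³ψ + C·c_reg` this is the regenerating version of `T4TrajectoryDensityFreshLaw.perStep_budget_of_pipeline`: one more
constant in the per-step rate, no summability. [folklore] -/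
theorem perStep_budget_of_envelope {resp : ℕ → ι → ℝ} {s₀ s₁ : ℕ → ℝ} {S : ℕ → Finset ι} {jb : ι → ℕ}
    {c N₀ Rhat Λ ρ₁ τ ρ sbar : ℝ} {K : ℕ} (hc : 0 ≤ c) (hN₀ : 0 ≤ N₀) (hRhat : 0 ≤ Rhat) (hΛ : 0 ≤ Λ) (hρ₁ : 0 ≤ ρ₁)
    (hτ0 : 0 ≤ τ) (hτ1 : τ ≤ 1) (hρlt : ρ < 1) (hprod : Λ * ρ₁ * τ ≤ ρ) (hs₀ : ∀ k, s₀ k ≤ sbar)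
    (hjb : ∀ k, ∀ f ∈ S k, jb f ≤ k)
    (hresp : EnvelopeResponse resp s₀ s₁ S jb Rhat ρ₁ τ K)
    (hcount : ∀ k, ∀ j ≤ k, (((S k).filter fun f => jb f = j).card : ℝ) ≤ N₀ * Λ ^ (k - j))
    (hs₁ : ∀ k < K, s₁ k ≤ c * ∑ f ∈ S k, resp k f)
    (hsmall : c * (N₀ * Rhat * 1 * (1 - ρ)⁻¹) ≤ 1 - sbar) :
    ∀ k < K, s₀ k + s₁ k ≤ 1 ∧ s₁ k ≤ c * (N₀ * Rhat * 1 * (1 - ρ)⁻¹) * τ ^ (K - k) := by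
  have hprod' : Λ * (Real.exp 3 * (ρ₁ / Real.exp 3)) * τ ≤ ρ := by
    rwa [show Real.exp 3 * (ρ₁ / Real.exp 3) = ρ₁ by field_simp]
  exact perStep_bootstrap hc hN₀ hRhat zero_le_one hΛ (div_nonneg hρ₁ (Real.exp_pos _).le) hτ0 hτ1 hρlt hprod' hs₀
    (freshLaw_of_envelope hc hρ₁ hτ0 hRhat hjb hresp hcount hs₁) hsmall

/-- THE CELL'S NUMBERS FOR THE FAMILY RATE: with `Λ = L⁴`, `τ = L⁻³` and `ρ₁ = e³·L⁻² + C·c_reg`, the strict product reads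
`e³/L + L·(C·c_reg) < 1` — the undressed O-G2 room `C·c_reg < (L − 1)/L²`-type condition of (w7) with one factor `e³` on the
transport part. [folklore] -/
theorem envelopeProduct_cell {L Cc : ℝ} (hL : 0 < L) :
    L ^ 4 * (Real.exp 3 * (L ^ 2)⁻¹ + Cc) * L⁻¹ ^ 3 = Real.exp 3 / L + L * Cc := by
  field_simp

end Envelope

end

end Summit.QuantumFields.BalabanUV.T4Continuum.T4TrajectoryDensityDressed
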